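import Summits.CriticalPhenomena.PercolationContinuityZ3.Theses.PercNearOneGluing
import Summits.CriticalPhenomena.PercolationContinuityZ3.Theorems.PercNearOneGluingNoHeavyLowerTailPocketSelectionBound
import Literature.Probability.Percolation.PercolationProofs

/-!
# Crux `PercNearOneGluing.NoHeavyLowerTail` (stmt-CriticalPhenomena-4575), line `bhk-superadditivity-thinning` —
# the residual follows from a SMALL SELECTION COST (typed next target, un-linearised form)

Lead `prover-line-stmt-CriticalPhenomena-4575-0`, 2026-08-16; lands with `--supports stmt-CriticalPhenomena-4575`.
Companion of `manyFingersLargePocket_of_cheapMonotoneCover` (p82405).  The landed `pocketSelectionBound`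
(p77174: Kozma–Nitzan arXiv:2401.12397 Thm 4 / Lemma 5 applied in the world where the observer's `A`-free
pocket `C*` is contracted to a point, through ANY admissible selection `sel`) gives, for every admissible
selection rule, `P(o ↔ A, o ↮ a₀) ≤ Σ_{S₀} P(C* = S₀, o ↔ A, sel S₀ ↮ a₀)` — the **selection cost**.  Hence
if for every `ε` there is `δ` such that every pairwise `δ`-reliable instance (hub `a₀ ∈ A`, observer
`o ∉ A`, `P(o ↮ A) ≤ δ`) admits an admissible `sel` of selection cost `≤ ε` (the hypothesis, "(SC)"), the
line's residual `stub_manyFingersLargePocket` holds (with `d₀ = 0`, `s₀ = 1`), hence the crux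
(`noHeavyLowerTail_of_manyFingersLargePocket`, p76496).  (SC) is what the monotone-cover price of p82405
linearises by Harris; it is a strengthening of the crux of unknown status.  Certified numerics (lead's notes
Cruxes/NoHeavyLowerTail/NOTES.md §3–5, work/cex/REPORT.md §9): with the oracle min-admissible selection the
ratio selection-cost / max_a P(a ↮ a₀) has sup 1.875 over 1 950 weight-optimised instances in 9 families
(constant 2 suffices everywhere computed; forced `max`-selections are unbounded).
-/

namespace Summit.CriticalPhenomena.PercolationContinuityZ3.Theorems

open scoped Classical BigOperators
open MeasureTheory Set
open Literature.Probability.LatticeModels (prodBernoulli)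
open Literature.Probability.Percolation (openConn openConnIn BondConfig measurableSet_openConn_holds)

/-- **A small selection cost implies the many-finger large-pocket residual.**  Given `ε`, take `δ` from
the selection-cost hypothesis; for an instance, the residual event (`o ↮ a₀`, `1 ≤ N'`, …) lies in
`{o ↔ A} ∩ {o ↮ a₀}`, whose probability `pocketSelectionBound` bounds by the selection cost of the
admissible `sel`, which is `≤ ε`.  [cite: KozmaNitzan2024, §3.2 Theorem 4 and Lemma 5 (pp. 12–14)] -/
theorem manyFingersLargePocket_of_selectionCost :
    (∀ ε : ℝ, 0 < ε → ∃ δ : ℝ, 0 < δ ∧ ∀ (n : ℕ) (w : Sym2 (Fin n) → unitInterval) (A : Finset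
      (Fin n)) (o a₀ : Fin n), a₀ ∈ A → o ∉ A → (∀ a ∈ A, ∀ a' ∈ A,
      (Literature.Probability.LatticeModels.prodBernoulli w).real
      (Literature.Probability.Percolation.openConn a a')ᶜ ≤ δ) →
      (Literature.Probability.LatticeModels.prodBernoulli w).real (⋃ a ∈ A,
      Literature.Probability.Percolation.openConn o a)ᶜ ≤ δ → ∃ sel : Finset (Fin n) → Fin n, (∀
      S₀ : Finset (Fin n), o ∈ S₀ → Disjoint S₀ A → ∀ v ∈ A, (∃ x ∈ S₀, w s(x, v) ≠ 0) →
      (Literature.Probability.LatticeModels.prodBernoulli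
      (Literature.Probability.Percolation.pinW w
      (Literature.Probability.Percolation.edgesTouching (↑S₀ : Set (Fin n))) (∅ : Set (Sym2 (Fin
      n))))).real (Literature.Probability.Percolation.openConn (sel S₀) a₀) ≤
      (Literature.Probability.LatticeModels.prodBernoulli
      (Literature.Probability.Percolation.pinW w
      (Literature.Probability.Percolation.edgesTouching (↑S₀ : Set (Fin n))) (∅ : Set (Sym2 (Fin
      n))))).real (Literature.Probability.Percolation.openConn v a₀)) ∧ ∑ S₀ ∈ (Finset.univ :
      Finset (Finset (Fin n))).filter (fun S₀ => o ∈ S₀ ∧ Disjoint S₀ A),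
      (Literature.Probability.LatticeModels.prodBernoulli w).real ({ω | ∀ v : Fin n, ω ∈
      Literature.Probability.Percolation.openConnIn (↑A : Set (Fin n))ᶜ o v ↔ v ∈ S₀} ∩ ((⋃ a ∈
      A, Literature.Probability.Percolation.openConn o a) ∩
      (Literature.Probability.Percolation.openConn (sel S₀) a₀)ᶜ)) ≤ ε) → (∀ ε : ℝ, 0 < ε → ∃ (δ
      : ℝ) (d₀ s₀ : ℕ), 0 < δ ∧ ∀ (n : ℕ) (w : Sym2 (Fin n) → unitInterval) (A : Finset (Fin n))
      (o a₀ : Fin n), a₀ ∈ A → o ∉ A → (∀ a ∈ A, ∀ a' ∈ A,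
      (Literature.Probability.LatticeModels.prodBernoulli w).real
      (Literature.Probability.Percolation.openConn a a')ᶜ ≤ δ) →
      (Literature.Probability.LatticeModels.prodBernoulli w).real (⋃ a ∈ A,
      Literature.Probability.Percolation.openConn o a)ᶜ ≤ δ →
      (Literature.Probability.LatticeModels.prodBernoulli w).real {ω :
      Literature.Probability.Percolation.BondConfig (Fin n) | ω ∉
      Literature.Probability.Percolation.openConn o a₀ ∧ s₀ ≤ ((A.erase a₀).filter fun a => ω ∈
      Literature.Probability.Percolation.openConn o a).card ∧ 2 * ((A.erase a₀).filter fun a => ω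
      ∈ Literature.Probability.Percolation.openConn o a).card ≤ A.card ∧ d₀ < (A.filter fun a =>
      ω ∈ Literature.Probability.Percolation.openConnIn ((↑A : Set (Fin n))ᶜ ∪ {o, a}) o a).card}
      ≤ ε) := by
  intro hC ε hε
  obtain ⟨δ, hδ, h⟩ := hC ε hε
  refine ⟨δ, 0, 1, hδ, fun n w A o a₀ ha₀ ho hpair hobs => ?_⟩
  obtain ⟨sel, hadm, hsum⟩ := h n w A o a₀ ha₀ ho hpair hobs
  have key := pocketSelectionBound' n w A o a₀ sel ho ha₀ hadm
  calc (prodBernoulli w).real {ω : BondConfig (Fin n) | ω ∉ openConn o a₀ ∧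
            1 ≤ ((A.erase a₀).filter fun a => ω ∈ openConn o a).card ∧
            2 * ((A.erase a₀).filter fun a => ω ∈ openConn o a).card ≤ A.card ∧
            0 < (A.filter fun a => ω ∈ openConnIn ((↑A : Set (Fin n))ᶜ ∪ {o, a}) o a).card}
        ≤ (prodBernoulli w).real ((⋃ a ∈ A, openConn o a) ∩ (openConn o a₀)ᶜ) := by
          refine measureReal_mono ?_
          rintro ω ⟨h1, h2, -, -⟩
          obtain ⟨a, ha⟩ := Finset.card_pos.mp h2
          rw [Finset.mem_filter] at ha
          exact ⟨Set.mem_iUnion₂.2 ⟨a, Finset.mem_of_mem_erase ha.1, ha.2⟩, h1⟩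
    _ ≤ ∑ S₀ ∈ (Finset.univ : Finset (Finset (Fin n))).filter (fun S₀ => o ∈ S₀ ∧ Disjoint S₀ A),
          (prodBernoulli w).real
            ({ω | ∀ v : Fin n, ω ∈ openConnIn (↑A : Set (Fin n))ᶜ o v ↔ v ∈ S₀} ∩
              ((⋃ a ∈ A, openConn o a) ∩ (openConn (sel S₀) a₀)ᶜ)) := key
    _ ≤ ε := hsum

end Summit.CriticalPhenomena.PercolationContinuityZ3.Theorems
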